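import Summits.QuantumFields.QCD.Theses.HeatSlicedQuarks
import Literature.MathematicalPhysics.QuantumLattice.OverlapLocality

/-!
# `AccretiveWilsonDirac` (stmt-QuantumFields-8875, route HeatSlicedQuarks, support) — proved

**Wilson-term accretivity** (exact identity validating the tree's `wilsonDirac` conventions): for every
periodic lattice `L`, every `SU(3)` gauge field `U`, every bare mass `m` and every colour–spin field
`v`,

`Re⟨v, D_W(U, m, 1) v⟩ = m‖v‖² + ½ Σ_{x,μ,a,α} ‖Σ_b ρ(U(x,μ))_{ab} v(x+μ̂, b, α) − v(x, a, α)‖²`.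

Proof (matrix form, any unitary representation `ρ`).  By the tree's
`wilsonDirac_eq_sub_sum_wilsonHop` (Hernández–Jansen–Lüscher (2.13)),
`D_W(U,m,1) = (m+4)·1 − Σ_μ W_μ` with `W_μ = F_μ ⊗ P⁻_μ + F_μᴴ ⊗ P⁺_μ` on (site ⊗ colour) ⊗ spin,
`F_μ` the `U`-twisted forward shift (`linkHop`) and `P^±_μ = ½(1 ± γ_μ)`.  Since `P⁺_μ` is Hermitian,
`(F_μ ⊗ P⁺_μ)ᴴ = F_μᴴ ⊗ P⁺_μ`, so `Re⟨v, (F_μᴴ ⊗ P⁺_μ)v⟩ = Re⟨v, (F_μ ⊗ P⁺_μ)v⟩` and, with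
`P⁻_μ + P⁺_μ = 1`, `Re⟨v, W_μ v⟩ = Re⟨v, T_μ v⟩` for the spin-trivial transport `T_μ = F_μ ⊗ 1`,
`(T_μ v)(x,a,α) = Σ_b ρ(U(x,μ))_{ab} v(x+μ̂,b,α)`.  `T_μ` is an isometry (`F_μᴴF_μ = 1`), whence
`Σ‖T_μ v − v‖² = 2‖v‖² − 2 Re⟨v, T_μ v⟩`; summing over `μ` gives the identity (the `4‖v‖²` of the
four directions is exactly the Wilson shift `m ↦ m + 4r` of the diagonal at `r = 1`).

The general-`ρ` statement is `re_quadForm_wilsonDirac_eq_wilsonTerm`; the route decl is its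
specialisation to `ρ = fundamentalRep (Fin 3)` (`accretiveWilsonDirac_proof`).
Helper shapes `sum_norm_sq_mulVec_sub_self`, `re_quadForm_wilsonDirac_eq` are adapted from the
(non-importable) crux workfile `Cruxes/TipPricing/Disproof.lean`.

References: K. G. Wilson, *Quarks and strings on a lattice* (Erice 1975) [Wilson1975];
I. Montvay, G. Münster, *Quantum Fields on a Lattice* (CUP 1994) §4.2.2, §5.1.1 [MontvayMunster1994];
P. Hernández, K. Jansen, M. Lüscher, Nucl. Phys. B 552 (1999) 363, (2.13) [HernandezJansenLuscher1999].
-/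

namespace Summit.QuantumFields.QCD.Theorems.HeatSlicedQuarksAccretiveWilsonDirac

open Literature.MathematicalPhysics.QuantumLattice Literature.MathematicalPhysics.QuantumFieldTheory
open Literature.Probability.LatticeModels Matrix
open scoped Kronecker

/-! ### Quadratic-form generalities over `ℂ` -/

section General

variable {n : Type*} [Fintype n]

/-- `Re⟨v, Mᴴ v⟩ = Re⟨v, M v⟩`: a matrix and its adjoint have the same real quadratic form.
[folklore] -/
theorem re_quadForm_conjTranspose (M : Matrix n n ℂ) (v : n → ℂ) :
    (star v ⬝ᵥ Mᴴ *ᵥ v).re = (star v ⬝ᵥ M *ᵥ v).re := by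
  have h : star v ⬝ᵥ Mᴴ *ᵥ v = star v ᵥ* Mᴴ ⬝ᵥ v := dotProduct_mulVec _ _ _
  rw [h, ← star_mulVec, star_dotProduct, Complex.star_def, Complex.conj_re]

/-- For an isometry `A` (`AᴴA = 1`): `Σ_i ‖(A v − v) i‖² = 2 Σ_i ‖v i‖² − 2 Re⟨v, A v⟩`. [folklore] -/
theorem sum_norm_sq_mulVec_sub_self [DecidableEq n] (A : Matrix n n ℂ) (hA : Aᴴ * A = 1)
    (v : n → ℂ) :
    ∑ i, ‖(A *ᵥ v - v) i‖ ^ 2 = 2 * ∑ i, ‖v i‖ ^ 2 - 2 * (star v ⬝ᵥ A *ᵥ v).re := by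
  -- `Re⟨w, w⟩ = Σ_i ‖w i‖²` (kept local: the standalone form already exists elsewhere in the tree)
  have hre : ∀ w : n → ℂ, (star w ⬝ᵥ w).re = ∑ i, ‖w i‖ ^ 2 := fun w => by
    rw [dotProduct, Complex.re_sum]
    refine Finset.sum_congr rfl fun i _ => ?_
    rw [Pi.star_apply, Complex.star_def, ← Complex.normSq_eq_conj_mul_self, Complex.ofReal_re,
      Complex.normSq_eq_norm_sq]
  rw [← hre, ← hre, star_sub,
    sub_dotProduct, dotProduct_sub, dotProduct_sub, star_mulVec, ← dotProduct_mulVec, mulVec_mulVec,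
    hA, one_mulVec, Complex.sub_re, Complex.sub_re, Complex.sub_re]
  have : (star v ᵥ* Aᴴ ⬝ᵥ v).re = (star v ⬝ᵥ A *ᵥ v).re := by
    rw [← star_mulVec, star_dotProduct, Complex.star_def, Complex.conj_re]
  rw [this]
  ring

end General

/-! ### The Wilson quadratic form -/

section Wilson

variable {L N : ℕ} {G : Type*} [Group G] (ρ : G →* Matrix (Fin N) (Fin N) ℂ) [NeZero L]

/-- `Re⟨v, W_μ v⟩ = Re⟨v, T_μ v⟩`: in the real quadratic form the chiral hopping matrix
`W_μ = F_μ ⊗ P⁻_μ + F_μᴴ ⊗ P⁺_μ` may be replaced by the spin-trivial transport `T_μ = F_μ ⊗ 1`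
(the `γ_μ`-parts are anti-Hermitian and drop out). [folklore] -/
theorem re_quadForm_wilsonHop_eq (U : GaugeConfig 4 L G) (μ : Fin 4)
    (v : TorusSite 4 L × Fin N × Fin 4 → ℂ) :
    (star v ⬝ᵥ wilsonHop ρ U μ *ᵥ v).re =
      (star v ⬝ᵥ Matrix.reindex (Equiv.prodAssoc _ _ _) (Equiv.prodAssoc _ _ _)
        (linkHop ρ U μ ⊗ₖ (1 : Matrix (Fin 4) (Fin 4) ℂ)) *ᵥ v).re := by
  have hT : ((linkHop ρ U μ ⊗ₖ chiralProjPlus μ).submatrix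
      (Equiv.prodAssoc (TorusSite 4 L) (Fin N) (Fin 4)).symm
      (Equiv.prodAssoc (TorusSite 4 L) (Fin N) (Fin 4)).symm)ᴴ =
      ((linkHop ρ U μ)ᴴ ⊗ₖ chiralProjPlus μ).submatrix
        (Equiv.prodAssoc (TorusSite 4 L) (Fin N) (Fin 4)).symm
        (Equiv.prodAssoc (TorusSite 4 L) (Fin N) (Fin 4)).symm := by
    rw [conjTranspose_submatrix, conjTranspose_kronecker, chiralProjPlus_conjTranspose]
  have hadd : ∀ A B : Matrix ((TorusSite 4 L × Fin N) × Fin 4) ((TorusSite 4 L × Fin N) × Fin 4) ℂ,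
      (A + B).submatrix (Equiv.prodAssoc (TorusSite 4 L) (Fin N) (Fin 4)).symm
          (Equiv.prodAssoc (TorusSite 4 L) (Fin N) (Fin 4)).symm =
        A.submatrix (Equiv.prodAssoc (TorusSite 4 L) (Fin N) (Fin 4)).symm
            (Equiv.prodAssoc (TorusSite 4 L) (Fin N) (Fin 4)).symm +
          B.submatrix (Equiv.prodAssoc (TorusSite 4 L) (Fin N) (Fin 4)).symm
            (Equiv.prodAssoc (TorusSite 4 L) (Fin N) (Fin 4)).symm := fun _ _ => rfl
  rw [wilsonHop, reindex_apply, reindex_apply, hadd, add_mulVec, dotProduct_add,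
    Complex.add_re, ← hT, re_quadForm_conjTranspose, ← Complex.add_re, ← dotProduct_add,
    ← add_mulVec, ← hadd, ← kronecker_add, chiralProjMinus_add_chiralProjPlus]

/-- The spin-trivial transport `T_μ = F_μ ⊗ 1` is an isometry: `T_μᴴ T_μ = 1`. [folklore] -/
theorem conjTranspose_mul_linkHopSpin (hρ : ∀ g, ρ g ∈ Matrix.unitaryGroup (Fin N) ℂ)
    (U : GaugeConfig 4 L G) (μ : Fin 4) :
    (Matrix.reindex (Equiv.prodAssoc _ _ _) (Equiv.prodAssoc _ _ _)
        (linkHop ρ U μ ⊗ₖ (1 : Matrix (Fin 4) (Fin 4) ℂ)))ᴴ *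
      Matrix.reindex (Equiv.prodAssoc _ _ _) (Equiv.prodAssoc _ _ _)
        (linkHop ρ U μ ⊗ₖ (1 : Matrix (Fin 4) (Fin 4) ℂ)) = 1 := by
  rw [reindex_apply, conjTranspose_submatrix, submatrix_mul_equiv, conjTranspose_kronecker,
    conjTranspose_one, ← mul_kronecker_mul, conjTranspose_mul_linkHop ρ hρ U μ, Matrix.mul_one,
    one_kronecker_one, submatrix_one_equiv]

/-- Entries of the spin-trivial transport: `(T_μ v)(x, a, α) = Σ_b ρ(U(x,μ))_{ab} v(x+μ̂, b, α)`.
[folklore] -/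
theorem linkHopSpin_mulVec_apply (U : GaugeConfig 4 L G) (μ : Fin 4)
    (v : TorusSite 4 L × Fin N × Fin 4 → ℂ) (x : TorusSite 4 L) (a : Fin N) (α : Fin 4) :
    (Matrix.reindex (Equiv.prodAssoc _ _ _) (Equiv.prodAssoc _ _ _)
        (linkHop ρ U μ ⊗ₖ (1 : Matrix (Fin 4) (Fin 4) ℂ)) *ᵥ v) (x, a, α) =
      ∑ b, ρ (U (x, μ)) a b * v (Site.shift x μ, b, α) := by
  simp only [mulVec, dotProduct]
  rw [Fintype.sum_prod_type, Finset.sum_eq_single (Site.shift x μ)]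
  · rw [Fintype.sum_prod_type]
    refine Finset.sum_congr rfl fun b _ => ?_
    rw [Finset.sum_eq_single α]
    · simp [linkHop]
    · intro β _ hβ
      simp [linkHop, Ne.symm hβ]
    · simp
  · intro y _ hy
    simp [linkHop, hy]
  · simp

/-- `Re⟨v, D_W(U,m,1) v⟩ = (m+4)‖v‖² − Σ_μ Re⟨v, W_μ v⟩` for unitary `ρ`.
[cite: HernandezJansenLuscher1999, (2.13)] -/
theorem re_quadForm_wilsonDirac_eq (hρ : ∀ g, ρ g ∈ Matrix.unitaryGroup (Fin N) ℂ)
    (U : GaugeConfig 4 L G) (m : ℝ) (v : TorusSite 4 L × Fin N × Fin 4 → ℂ) :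
    (star v ⬝ᵥ wilsonDirac ρ U m 1 *ᵥ v).re =
      (m + 4) * ∑ i, ‖v i‖ ^ 2 - ∑ μ, (star v ⬝ᵥ wilsonHop ρ U μ *ᵥ v).re := by
  have hre : (star v ⬝ᵥ v).re = ∑ i, ‖v i‖ ^ 2 := by
    rw [dotProduct, Complex.re_sum]
    refine Finset.sum_congr rfl fun i _ => ?_
    rw [Pi.star_apply, Complex.star_def, ← Complex.normSq_eq_conj_mul_self, Complex.ofReal_re,
      Complex.normSq_eq_norm_sq]
  rw [wilsonDirac_eq_sub_sum_wilsonHop ρ hρ U m, sub_mulVec, smul_mulVec, one_mulVec, sum_mulVec,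
    dotProduct_sub, dotProduct_smul, dotProduct_sum, Complex.sub_re, smul_eq_mul,
    Complex.re_ofReal_mul, Complex.re_sum, hre]

/-- **Wilson-term accretivity, general unitary representation**:
`Re⟨v, D_W(U,m,1) v⟩ = m Σ‖v_i‖² + ½ Σ_{x,μ,a,α} ‖Σ_b ρ(U(x,μ))_{ab} v(x+μ̂,b,α) − v(x,a,α)‖²`
(Montvay–Münster §4.2.2/§5.1.1; the form identity behind Wilson's removal of the doublers).
[cite: MontvayMunster1994, §4.2.2 (4.85) with §5.1.1 (5.5)] -/
theorem re_quadForm_wilsonDirac_eq_wilsonTerm (hρ : ∀ g, ρ g ∈ Matrix.unitaryGroup (Fin N) ℂ)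
    (U : GaugeConfig 4 L G) (m : ℝ) (v : TorusSite 4 L × Fin N × Fin 4 → ℂ) :
    (∑ i, star (v i) * (wilsonDirac ρ U m 1 *ᵥ v) i).re =
      m * ∑ i, ‖v i‖ ^ 2 + (1 / 2 : ℝ) * ∑ x : TorusSite 4 L, ∑ μ : Fin 4, ∑ a : Fin N, ∑ α : Fin 4,
        ‖(∑ b : Fin N, ρ (U (x, μ)) a b * v (Site.shift x μ, b, α)) - v (x, a, α)‖ ^ 2 := by
  have hLHS : (∑ i, star (v i) * (wilsonDirac ρ U m 1 *ᵥ v) i) =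
      star v ⬝ᵥ wilsonDirac ρ U m 1 *ᵥ v := rfl
  rw [hLHS, re_quadForm_wilsonDirac_eq ρ hρ U m v, Finset.sum_comm]
  have hμ : ∀ μ : Fin 4, ∑ x : TorusSite 4 L, ∑ a : Fin N, ∑ α : Fin 4,
      ‖(∑ b : Fin N, ρ (U (x, μ)) a b * v (Site.shift x μ, b, α)) - v (x, a, α)‖ ^ 2 =
      2 * ∑ i, ‖v i‖ ^ 2 - 2 * (star v ⬝ᵥ wilsonHop ρ U μ *ᵥ v).re := by
    intro μ
    rw [re_quadForm_wilsonHop_eq, ← sum_norm_sq_mulVec_sub_self _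
      (conjTranspose_mul_linkHopSpin ρ hρ U μ) v, Fintype.sum_prod_type]
    refine Finset.sum_congr rfl fun x _ => ?_
    rw [Fintype.sum_prod_type]
    refine Finset.sum_congr rfl fun a _ => Finset.sum_congr rfl fun α _ => ?_
    rw [Pi.sub_apply, linkHopSpin_mulVec_apply]
  simp_rw [hμ]
  rw [Finset.sum_sub_distrib, Finset.sum_const, Finset.card_univ, Fintype.card_fin, ← Finset.mul_sum]
  simp only [nsmul_eq_mul, Nat.cast_ofNat]
  ring

end Wilson

/-- **`AccretiveWilsonDirac` holds** (stmt-QuantumFields-8875): the route decl, i.e.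
`re_quadForm_wilsonDirac_eq_wilsonTerm` at `ρ = fundamentalRep (Fin 3)` (unitary by
`fundamentalRep_mem_unitaryGroup`). [cite: MontvayMunster1994, §4.2.2 (4.85) with §5.1.1 (5.5)] -/
theorem accretiveWilsonDirac_proof :
    Summit.QuantumFields.QCD.Theses.HeatSlicedQuarks.AccretiveWilsonDirac := by
  intro L _ U m v
  exact re_quadForm_wilsonDirac_eq_wilsonTerm (fundamentalRep (Fin 3))
    fundamentalRep_mem_unitaryGroup U m v

end Summit.QuantumFields.QCD.Theorems.HeatSlicedQuarksAccretiveWilsonDirac
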